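import Mathlib
import Literature.NumberTheory.LFunctions.Zhang2022.Section17Step17u011
import Literature.NumberTheory.LFunctions.Zhang2022.Section17Eq172
import HarnessLib

/-!
# Zhang (2022) §17 (17.7), the assembly: `Σ_{ψ∈Ψ₁}(p_ψt₀)^{β₃}I₄⁻(ψ) = Σ_{p∼P}(pt₀)^{β₂}Φ₃⁻(p) + o(𝔓)`
# from Proposition 2.2 and the `Ψ₁ → Ψ` extension error on `𝔍(−1)`

Topic `Literature/NumberTheory/LFunctions/Zhang2022` (Landau–Siegel audit tree; verdict-neutral).
Y. Zhang, *Discrete mean estimates and the Landau–Siegel zero*, arXiv:2211.02515v1 (2022)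
[Zhang2022LandauSiegel] — **an unrefereed manuscript under adjudication; nothing here asserts or
denies its Theorems 1–2, and no claim about Landau–Siegel zeros is made.** ZHANG-L discharge lane,
WP16 (seat zl-w16-p7; the typed node `Typed.Section17.Eq17_7 c′` is the input `Eq17_7` of the leaf
edge `Phi3Eval.eq17_9Rel_of_chiNodes` toward `Typed.Section17.Eq17_9Rel`). DAG node `Z22:(17.7)`
[Z22 p. 97, tex L4775–L4789]:

> "Thus, in a way similar to the proof of (15.4),
> `Σ_{ψ∈Ψ₁}(p_ψt₀)^{β₃}I₃⁻(ψ) = Σ_{ψ∈Ψ₁}(p_ψt₀)^{β₂}(1/2πi)∫_{𝔍(−α)}𝔨₃*(s,ψ)ω(s)ds + o(𝔓)` …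
> Moving the segment `𝔍(−α)` to `𝔍(−1)` and then extend the sum over `Ψ₁` to the sum over `Ψ` we
> obtain `Σ_{ψ∈Ψ₁}(p_ψt₀)^{β₃}I₃⁻(ψ) = Σ_{p∼P}(pt₀)^{β₂}Φ₃⁻(p) + o(𝔓)`"  (17.7)

(print defect `I₃⁻ ↦ I₄⁻` as typed). This file ASSEMBLES (17.7) from three kernel pieces and ONE
named input:

* (a) §17.u011 — `Typed.Section17.step17_u011_of_prop22` (`Section17Step17u011`; Lemma 5.1 at rate
  `𝓛⁻¹²³`, Lemma 5.9, the loss-free mean value of `B·G·N·N·F̄`, (7.4));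
* (b) the move `𝔍(−α) → 𝔍(−1)` on `Ψ₁` — `Eq177.eq17_7a_of_prop22i` (`Section17Eq177Shift`; Cauchy–
  Goursat on `[−½, ½−α] × [2πt₀ ∓ 𝓛₁]`, error `≤ e^{−𝓛¹⁰/16}`);
* (c) the regrouping `Σ_{ψ∈Ψ}(p_ψt₀)^{β₂}(1/2πi)∫_{𝔍(−1)}𝔨₃*ω = Σ_{p∼P}(pt₀)^{β₂}Φ₃⁻(p)`
  (`sum_univ_weighted_segInt_eq_sum_Phi3minus`: `Ψ = ⊔_{p∼P}{ψ (mod p)}`, `Φ₃⁻(p)` =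
  `Typed.Section17.Phi3minus`), with `Ψ = Ψ₁ ⊔ Ψ₂` (`Typed.Sec14.Eq143.sum_finsetOf_univ_eq`);
* (d) the INPUT `hext` — the `Ψ₁ → Ψ` EXTENSION ERROR on `𝔍(−1)`:
  `‖Σ_{ψ∈Ψ₂}(p_ψt₀)^{β₂}(1/2πi)∫_{𝔍(−1)}𝔨₃*(s,ψ)ω(s)ds‖ ≤ ε𝔓` eventually, for every `ε > 0`
  (the source's "extend the sum over `Ψ₁` to the sum over `Ψ` with an acceptable error", by the
  (7.3)–(7.5) method: Hölder, Lemma 3.3 (ii), Proposition 2.1; the twin of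
  `Eq172.norm_sum_PsiTwo_weighted_le` for (17.2), lane seat zl-w14-p2 per WP16 ruling W16-S5a (6b)) —
  stated INLINE as a hypothesis (no new definition, no new claim node).

Results: `Eq177.eq17_7_of_ext : 0 ≤ c′ → Prop22 c′ → hext(c′) → Eq17_7 c′` and
`Eq177.eq17_7_eventually_of_ext : (∀ c′, hext(c′)) → ∃ c₀ ≥ 0, ∀ c′ ≥ c₀, Eq17_7 c′` (Prop. 2.2 for
every large `c′` is the tree's `Skeleton.prop22_eventually`). Theorems only; axioms standard.
WHAT THIS IS NOT: a proof of the extension error (d), of (17.8)–(17.10), or of any leaf.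

## References

* Y. Zhang, arXiv:2211.02515v1 (2022), §17 (17.7) p. 97 (tex L4775–L4789); §7 (7.3)–(7.5) pp. 34–35;
  §2 Prop. 2.2. [cite: Zhang2022LandauSiegel, §17 (17.7) p. 97]
-/

noncomputable section

open Finset Complex Real
open Literature.NumberTheory.LFunctions.Zhang2022.Skeleton
open Literature.NumberTheory.LFunctions.Zhang2022.Typed.Section17

namespace Literature.NumberTheory.LFunctions.Zhang2022.Eq177

/-! ## Bookkeeping: `Σ_Ψ = Σ_{p∼P} Σ*_{ψ (mod p)}` for the `Φ₃⁻` side -/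

/-- **`Σ_{ψ∈Ψ}(p_ψt₀)^{β₂}(1/2πi)∫_{𝔍(−1)}𝔨₃*(s,ψ)ω(s)ds = Σ_{p∼P}(pt₀)^{β₂}Φ₃⁻(p)`**
(`Φ₃⁻(p) = Σ*_{ψ (mod p)}(1/2πi)∫_{𝔍(−1)}𝔨₃*ω`, §17 p. 97 "where …"). [cite: Zhang2022LandauSiegel, §17 u013 p.97] -/
theorem sum_univ_weighted_segInt_eq_sum_Phi3minus (c' : ℝ) {D : ℕ} [NeZero D]
    (χ : DirichletCharacter ℂ D) :
    ∑ x ∈ finsetOf (Set.univ : Set (Chr D)), (((x.p : ℝ) * t0 D : ℝ) : ℂ) ^ beta2 c' D *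
        Lemma81.segInt (t0 D) (ell1 D) (-1) (fun s => kfrak3Star c' χ x s * omegaW D s) =
      ∑ p ∈ primeWindow D, (((p : ℝ) * t0 D : ℝ) : ℂ) ^ beta2 c' D * Phi3minus c' χ p := by
  rw [Typed.Sec14.sum_finsetOf_univ_eq_sum_primeWindow]
  refine Finset.sum_congr rfl fun p _ => ?_
  rw [Phi3minus, chrMod, Finset.mul_sum]
  refine Finset.sum_congr rfl fun x hx => ?_
  have hx' : x.p = p := by
    have := mem_of_mem_finsetOf hx
    simpa using this
  rw [hx']

/-! ## (17.7) from Proposition 2.2 and the extension error -/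

/-- **(17.7) ASSEMBLED** (§17 p. 97, tex L4775–L4789): for `0 ≤ c′`, `Prop22 c′`, and the `Ψ₁ → Ψ`
extension error on `𝔍(−1)` (hypothesis `hext`, the source's "extend the sum over `Ψ₁` to the sum over
`Ψ` with an acceptable error"), the typed node `Typed.Section17.Eq17_7 c′` holds:
`‖Σ_{ψ∈Ψ₁}(p_ψt₀)^{β₃}I₄⁻(ψ) − Σ_{p∼P}(pt₀)^{β₂}Φ₃⁻(p)‖ ≤ ε𝔓` eventually, every `ε > 0`. Pieces:
§17.u011 (`step17_u011_of_prop22`, `ε/3`), the move `𝔍(−α) → 𝔍(−1)` (`eq17_7a_of_prop22i`,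
`Ce^{−c𝓛¹⁰} ≤ (ε/3)𝔓` as `𝔓 ≥ D`), `hext` (`ε/3`), and the regrouping over `Ψ = Ψ₁ ⊔ Ψ₂ = ⊔_{p∼P}`.
[cite: Zhang2022LandauSiegel, §17 (17.7) p.97] -/
theorem eq17_7_of_ext {c' : ℝ} (hc' : 0 ≤ c') (h22 : Prop22 c')
    (hext : ∀ ε : ℝ, 0 < ε → ForAllLarge fun D _ χ => AssumptionA D χ →
      ‖∑ x ∈ finsetOf (PsiTwo χ), (((x.p : ℝ) * t0 D : ℝ) : ℂ) ^ beta2 c' D *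
          Lemma81.segInt (t0 D) (ell1 D) (-1) (fun s => kfrak3Star c' χ x s * omegaW D s)‖ ≤
        ε * frakP D) :
    Eq17_7 c' := by
  intro ε hε
  have hε3 : 0 < ε / 3 := by positivity
  have h11 := step17_u011_of_prop22 hc' h22 (ε / 3) hε3
  obtain ⟨c, hc, C, ha⟩ := eq17_7a_of_prop22i h22.1 c'
  have hb := hext (ε / 3) hε3
  -- `C e^{−c𝓛¹⁰} ≤ (ε/3) D ≤ (ε/3)𝔓` for large `D`
  obtain ⟨D₁, hD₁⟩ := Eq172.const_mul_ell_pow_le_self 0 (3 * max C 0 / ε)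
  refine ((((h11.and ha).and hb).and Phi3Eval.forAllLarge_self_le_frakP).and
    (ForAllLarge.of_le D₁ (S := fun D _ _ => D₁ ≤ D) fun _ _ _ hD _ _ => hD)).mono ?_
  intro D _ χ hq hp h hA
  obtain ⟨⟨⟨⟨h11D, haD⟩, hbD⟩, hPD⟩, hD₁'⟩ := h
  have h11D := h11D hA
  have haD := haD hA
  have hbD := hbD hA
  have hkey : 3 * max C 0 / ε ≤ D := by have := hD₁ D hD₁'; simpa using this
  set S₁ : ℂ := ∑ x ∈ finsetOf (PsiOne χ), (((x.p : ℝ) * t0 D : ℝ) : ℂ) ^ beta3 c' D *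
    I4 c' χ x (-alpha D) with hS₁
  set Jα : ℂ := ∑ x ∈ finsetOf (PsiOne χ), (((x.p : ℝ) * t0 D : ℝ) : ℂ) ^ beta2 c' D *
    Lemma81.segInt (t0 D) (ell1 D) (-(alpha D : ℂ)) (fun s => kfrak3Star c' χ x s * omegaW D s)
    with hJα
  set J₁ : ℂ := ∑ x ∈ finsetOf (PsiOne χ), (((x.p : ℝ) * t0 D : ℝ) : ℂ) ^ beta2 c' D *
    Lemma81.segInt (t0 D) (ell1 D) (-1) (fun s => kfrak3Star c' χ x s * omegaW D s) with hJ₁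
  set J₂ : ℂ := ∑ x ∈ finsetOf (PsiTwo χ), (((x.p : ℝ) * t0 D : ℝ) : ℂ) ^ beta2 c' D *
    Lemma81.segInt (t0 D) (ell1 D) (-1) (fun s => kfrak3Star c' χ x s * omegaW D s) with hJ₂
  set T : ℂ := ∑ p ∈ primeWindow D, (((p : ℝ) * t0 D : ℝ) : ℂ) ^ beta2 c' D * Phi3minus c' χ p
    with hT
  have hreg : J₁ + J₂ = T := by
    rw [hJ₁, hJ₂, hT, ← Typed.Sec14.Eq143.sum_finsetOf_univ_eq,
      sum_univ_weighted_segInt_eq_sum_Phi3minus]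
  -- the exponentially small term against `(ε/3)𝔓`
  have hexp : C * Real.exp (-c * ell D ^ 10) ≤ ε / 3 * frakP D := by
    have hℓ0 : 0 ≤ ell D := Real.log_natCast_nonneg D
    have he : Real.exp (-c * ell D ^ 10) ≤ 1 := by
      rw [Real.exp_le_one_iff]
      have : 0 ≤ c * ell D ^ 10 := by positivity
      linarith
    have hC : C * Real.exp (-c * ell D ^ 10) ≤ max C 0 := by
      calc C * Real.exp (-c * ell D ^ 10) ≤ max C 0 * Real.exp (-c * ell D ^ 10) :=
            mul_le_mul_of_nonneg_right (le_max_left _ _) (Real.exp_pos _).le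
        _ ≤ max C 0 * 1 := mul_le_mul_of_nonneg_left he (le_max_right _ _)
        _ = max C 0 := mul_one _
    have hD : max C 0 ≤ ε / 3 * D := by
      have h := mul_le_mul_of_nonneg_left hkey hε3.le
      calc max C 0 = ε / 3 * (3 * max C 0 / ε) := by field_simp
        _ ≤ ε / 3 * D := h
    calc C * Real.exp (-c * ell D ^ 10) ≤ max C 0 := hC
      _ ≤ ε / 3 * D := hD
      _ ≤ ε / 3 * frakP D := mul_le_mul_of_nonneg_left hPD hε3.le
  calc ‖S₁ - T‖ = ‖(S₁ - Jα) + (Jα - J₁) - J₂‖ := by rw [← hreg]; ring_nf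
    _ ≤ ‖(S₁ - Jα) + (Jα - J₁)‖ + ‖J₂‖ := norm_sub_le _ _
    _ ≤ ‖S₁ - Jα‖ + ‖Jα - J₁‖ + ‖J₂‖ := by gcongr; exact norm_add_le _ _
    _ ≤ ε / 3 * frakP D + C * Real.exp (-c * ell D ^ 10) + ε / 3 * frakP D :=
        add_le_add (add_le_add h11D haD) hbD
    _ ≤ ε / 3 * frakP D + ε / 3 * frakP D + ε / 3 * frakP D := by gcongr
    _ = ε * frakP D := by ring

/-- **(17.7) EVENTUALLY in `c′`, from the extension error for every `c′`**: some `c₀ ≥ 0` with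
`Eq17_7 c′` for all `c′ ≥ c₀` (Prop. 2.2 for large `c′` is the tree's `Skeleton.prop22_eventually`).
[cite: Zhang2022LandauSiegel, §17 (17.7) p.97; §2 Prop. 2.2] -/
theorem eq17_7_eventually_of_ext {c₁ : ℝ}
    (hext : ∀ c' : ℝ, c₁ ≤ c' → ∀ ε : ℝ, 0 < ε → ForAllLarge fun D _ χ => AssumptionA D χ →
      ‖∑ x ∈ finsetOf (PsiTwo χ), (((x.p : ℝ) * t0 D : ℝ) : ℂ) ^ beta2 c' D *
          Lemma81.segInt (t0 D) (ell1 D) (-1) (fun s => kfrak3Star c' χ x s * omegaW D s)‖ ≤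
        ε * frakP D) :
    ∃ c₀ : ℝ, 0 ≤ c₀ ∧ ∀ c' : ℝ, c₀ ≤ c' → Eq17_7 c' := by
  obtain ⟨c₀, hc₀, h⟩ := prop22_eventually
  refine ⟨max c₀ c₁, le_trans hc₀ (le_max_left _ _), fun c' hc' => ?_⟩
  exact eq17_7_of_ext (hc₀.trans ((le_max_left _ _).trans hc')) (h c' ((le_max_left _ _).trans hc'))
    (hext c' ((le_max_right _ _).trans hc'))

end Literature.NumberTheory.LFunctions.Zhang2022.Eq177
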